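import Literature.MathematicalPhysics.QuantumLattice.XYZGroundStateOrderSpinHalfHolds
import Literature.MathematicalPhysics.QuantumLattice.XYZGroundStateOrderCorrIneq
import Literature.MathematicalPhysics.QuantumLattice.HeisenbergOrderNeelAssembly
import Literature.MathematicalPhysics.QuantumLattice.HeisenbergOrderNeelRiemann3
import Literature.MathematicalPhysics.QuantumLattice.XYOrderRiemannSumProofs
import Literature.MathematicalPhysics.QuantumLattice.XYOrderIntegralDimProofs
import Mathlib.Combinatorics.SimpleGraph.DegreeSum
import HarnessLib

/-!
# Björnberg–Ueltschi, Theorem 3.2 (ground state, general window): discharge of `bjornbergUeltschi2022_ground_lro`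

Sibling proof file of `XYZGroundStateOrder.lean` (named fact `bjornbergUeltschi2022_ground_lro`,
item `provefact-Literature.MathematicalPhysics.QuantumLa-21c7c447df`). No statement of the tree is
changed and **no named fact and no definition is introduced**: everything here is proved, on top of

* `XYZGroundStateOrderProofs.lean` (the finite-volume architecture in the rotated frame
  `H' = H(1, J₂, J₁)`, written for the spin-½ window but stated for all `d`, `n`, `J`: the objects
  `xyzGroundCorr`/`xyzStructureFactor`/`xyzBondCorr` — B–U's axes `(1,2,3)` are the components
  `(2,1,0)` there —, the sum rule (C) `xyz_structureFactor_sumRule` (B–U (4.38)), the polarised-state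
  bound (V) `xyz_polarised_bound`, the orbit inequalities (O) `xyz_orbit_inequalities`, the `T = 0`
  infrared bound (A) `xyz_infraredBound_of_groundEnergy_le` (B–U Lemma 4.4 at `β = ∞`), and the
  identification of the order parameter `xyz_lroSeq_eq`);
* `XYZGroundStateOrderGD.lean` / `XYZGroundStateOrderSpinHalfHolds.lean` (ground-state Gaussian
  domination by reflection positivity, B–U Lemma 5.2 / Cor. 5.3 at `β = ∞`, in the shape consumed by
  (A): `buSpinHalf_gaussianDomination`, all `d`, `n`, `0 ≤ J₁`, `J₂ ≤ 0`);
* `XYZGroundStateOrderCorrIneq.lean` (B–U **Lemma A.1** in the ground state for the three-coupling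
  bond Hamiltonian `H₃(a,b,c)`, by entrywise positivity of the ground-state projection of a
  stoquastic matrix, and its transport by the cyclic permutation of the spin axes).

## What is new here (B–U, pp. 10–11: "all dimensions `d ≥ 2` and all spins, with the one exception `d = 2`, `S = ½`")

* `anisotropicTorus_eq_two_smul_three`: B–U's ordered-pair Hamiltonian `H(a,b,c)` is twice the bond
  form `H₃(a,b,c)` of the correlation-inequality file, so both have the same tracial ground state;
* the *swap* frame (quarter turn about the third axis, `H₃(a,b,c) ↦ H₃(b,a,c)`), which together
  with the cyclic frame of the correlation-inequality file turns Lemma A.1 into the inequality the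
  assembly needs in the rotated frame: **`|c¹| ≤ c²` for `|J₂| ≤ J₁`** (`xyz_abs_bondCorr_one_le_two`;
  B–U: `|⟨S⁽²⁾S⁽²⁾⟩| ≤ ⟨S⁽¹⁾S⁽¹⁾⟩`), INCLUDING the corner `-J₂ = J₁` of the window where Kubo's
  variational orbit inequality (O)(iii) is void; `c² ≤ c⁰` for `J₁ ≤ 1` is (O)(iv) plus the
  `J₁ = 1` symmetry (`xyz_bondCorr_two_le_zero`);
* **the general assembly** `xyz_lro_of_infraredBound`: from (A), `|c¹| ≤ c² ≤ c⁰` and an eventual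
  bound `R_L(d) ≤ ρ < n/√6` on the punctured Riemann sums of the KLS integrand (B–U's `Ĩ⁽ᵈ⁾_ℓ`,
  (3.6) = the tree's `klsRiemannSum d L`): (C)+(A)+`|β'| ≤ α'` give B–U (4.39)–(4.40),
  `c⁰ ≤ |Λ|⁻¹ĝ₀ + ½√α' R_L` (`xyz_ineq`), while `c⁰ ≥ max(S² - α', α'/2)` ((V), and (4.42):
  `α' ≤ (J₁ - J₂)c² ≤ 2c² ≤ 2c⁰`), whence `|Λ|⁻¹ĝ₀ ≥ ½t⋆(t⋆ - R_L)`, `t⋆ = n/√6`;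
* `xyz_riemannSum_eventually_lt`: the numerical input for every `(d, S) ≠ (2, ½)` is already in the
  tree — `klsRiemannSum_three_eventually_le` (`R_L(3) ≤ 2/5 < 1/√6`), transported to all `d ≥ 3` by
  `klsRiemannSum_tendsto_holds` and `klsIntegral_antitone`, and `klsRiemannSum_eventually_le`
  (`≤ 0.69 < 2/√6`) for `S ≥ 1`;
* **`bjornbergUeltschi2022_ground_lro_holds`**.

**Deviation from print (recorded, not hidden).** B–U conclude from BOTH bounds of Theorem 3.2 and the
numerical Table 1 (condition (3.9)). In the ground state the second bound together with the
variational bound (V) closes under the SAME threshold the tree certified for the Néel case: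
`max(S² - a, a/2) - ½√a R > 0` for all `a ≥ 0` iff `R < 2S/√6`. So the first bound (which needs
`⟨(S³)²⟩ ≥ S(S+1)/3` and the second lattice integral `I⁽ᵈ⁾`) is not used; the window proved is
exactly the vendored one.

## References

* [BjornbergUeltschi2022] Theorem 3.2, (3.6)–(3.9), Table 1, (4.38)–(4.42), Prop. 2.4, Lemma A.1.
* [KLS1988PRL] (the lattice integral `I(ν)` = B–U's `Ĩ⁽ν⁾` and its monotonicity in `ν`).
-/

noncomputable section

open Filter Topology Matrix Finset
open Literature.MathematicalPhysics.QuantumLattice Literature.MathematicalPhysics.QuantumLattice.SpinOperators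
  Literature.Probability.LatticeModels

namespace Literature.MathematicalPhysics.QuantumLattice

variable {d : ℕ}

/-! ### Ordered pairs versus edges -/

section Pairs

variable {V : Type*} [Fintype V] [DecidableEq V]

/-- **Ordered adjacent pairs are the darts**: `Σ_x Σ_y [x ∼ y] f(x,y) = Σ_{e={x,y}} (f(x,y) + f(y,x))`
(each edge of a simple graph carries exactly two darts, Mathlib `SimpleGraph.Dart.edge_fiber`).
[folklore] -/
theorem sum_sum_ite_adj_eq_sum_edgeFinset (G : SimpleGraph V) [DecidableRel G.Adj]
    {M : Type*} [AddCommMonoid M] (f : V → V → M) :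
    ∑ x, ∑ y, (if G.Adj x y then f x y else 0) =
      ∑ e ∈ G.edgeFinset, Sym2.lift ⟨fun x y => f x y + f y x, fun _ _ => add_comm _ _⟩ e := by
  classical
  -- (1) the double sum is a sum over darts
  have h1 : ∑ x, ∑ y, (if G.Adj x y then f x y else 0) = ∑ a : G.Dart, f a.fst a.snd := by
    rw [← Finset.sum_product' (f := fun x y => if G.Adj x y then f x y else 0), univ_product_univ,
      ← Finset.sum_filter]
    refine Finset.sum_bij' (fun p hp => (⟨p, (mem_filter.1 hp).2⟩ : G.Dart))
      (fun a _ => a.toProd) ?_ ?_ ?_ ?_ ?_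
    · intro p hp; exact mem_univ _
    · intro a _; exact mem_filter.2 ⟨mem_univ _, a.adj⟩
    · intro p hp; rfl
    · intro a _; rfl
    · intro p hp; rfl
  -- (2) group the darts by their edge
  have h2 : ∑ a : G.Dart, f a.fst a.snd =
      ∑ e ∈ G.edgeFinset, ∑ a ∈ (univ : Finset G.Dart).filter (fun a => a.edge = e),
        f a.fst a.snd := by
    rw [Finset.sum_fiberwise_of_maps_to]
    intro a _
    rw [SimpleGraph.mem_edgeFinset]
    exact a.edge_mem
  rw [h1, h2]
  refine Finset.sum_congr rfl fun e he => ?_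
  induction e using Sym2.ind with
  | h x y =>
    have hadj : G.Adj x y := by rwa [SimpleGraph.mem_edgeFinset, SimpleGraph.mem_edgeSet] at he
    set a : G.Dart := ⟨(x, y), hadj⟩ with ha
    have hfib : (univ : Finset G.Dart).filter (fun a' => a'.edge = s(x, y)) = {a, a.symm} := by
      have := a.edge_fiber
      rw [ha, SimpleGraph.Dart.edge_mk] at this
      simpa [ha] using this
    rw [hfib, Finset.sum_pair a.symm_ne.symm, Sym2.lift_mk]
    rfl

end Pairs

/-! ### B–U's Hamiltonian is twice the three-coupling bond form -/

section Three

variable (L : ℕ) [NeZero L] (n : ℕ)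

/-- `Sᵅ_xSᵅ_y + Sᵅ_ySᵅ_x = 2 bᵅ_{xy}`. [folklore] -/
theorem siteSpin_mul_add_eq_two_smul_spinBond {Λ : Type*} [Fintype Λ] [DecidableEq Λ] (α : Fin 3)
    (x y : Λ) :
    siteSpin n x α * siteSpin n y α + siteSpin n y α * siteSpin n x α = (2 : ℂ) • spinBond n α x y := by
  rw [spinBond, smul_smul]
  norm_num

/-- **B–U's Hamiltonian (2.4) is twice the bond form**: `H(a,b,c) = 2 H₃(a,b,c)`, the sum over
ORDERED adjacent pairs counting every bond twice. [cite: BjornbergUeltschi2022, eq. (2.4)] -/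
theorem anisotropicTorus_eq_two_smul_three (a b c : ℝ) :
    anisotropicTorus d L n a b c = (2 : ℂ) • xyzBondHamiltonian₃ L n a b c := by
  rw [anisotropicTorus, xyzBondHamiltonian₃, smul_neg, Finset.smul_sum, sum_sum_ite_adj_eq_sum_edgeFinset]
  congr 1
  refine Finset.sum_congr rfl fun e _ => ?_
  induction e using Sym2.ind with
  | h x y =>
    simp only [Sym2.lift_mk, xyzBond₃, smul_add, smul_smul]
    rw [mul_comm (2 : ℂ) (a : ℂ), mul_comm (2 : ℂ) (b : ℂ), mul_comm (2 : ℂ) (c : ℂ), ← smul_smul,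
      ← smul_smul, ← smul_smul, ← siteSpin_mul_add_eq_two_smul_spinBond,
      ← siteSpin_mul_add_eq_two_smul_spinBond, ← siteSpin_mul_add_eq_two_smul_spinBond, smul_add,
      smul_add, smul_add]
    abel

/-- **Same ground states**: `ω_{H(a,b,c)} = ω_{H₃(a,b,c)}` (`ω_{2K} = ω_K`).
[cite: BjornbergUeltschi2022, §2 (p. 4)] -/
theorem groundStateFunctional_anisotropicTorus_three (a b c : ℝ) :
    (anisotropicTorus d L n a b c).groundStateFunctional =
      (xyzBondHamiltonian₃ L n a b c).groundStateFunctional := by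
  rw [anisotropicTorus_eq_two_smul_three, show (2 : ℂ) = ((2 : ℝ) : ℂ) by norm_num,
    Matrix.groundStateFunctional_smul_of_pos (xyzBondHamiltonian₃_isHermitian L n a b c) two_pos]

/-! ### The swap frame: the quarter turn about the third axis, `H₃(a,b,c) ↦ H₃(b,a,c)` -/

/-- **The swap frame on the torus**: the product unitary of the quarter turn about the third axis
(`Sˣ ↦ -Sʸ`, `Sʸ ↦ Sˣ`, `Sᶻ ↦ Sᶻ`, `exists_unitary_conj_spinX_eq_neg_spinY`) conjugates
`H₃(a,b,c)` into `H₃(b,a,c)` (`b⁰ ↦ b¹`, `b¹ ↦ b⁰`, `b² ↦ b²`); B–U Prop. 2.4 for the transposition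
`ρ = (1 2)`. [cite: BjornbergUeltschi2022, Proposition 2.4] -/
theorem exists_swap_xyzBondHamiltonian₃ (a b c : ℝ) :
    ∃ U : Op (TorusSite d L) (n + 1), U * Uᴴ = 1 ∧ Uᴴ * U = 1 ∧
      U * xyzBondHamiltonian₃ (d := d) L n a b c * Uᴴ = xyzBondHamiltonian₃ L n b a c ∧
      (∀ x, U * siteSpin n x 0 * Uᴴ = -siteSpin n x 1) ∧
      (∀ x, U * siteSpin n x 1 * Uᴴ = siteSpin n x 0) ∧
      (∀ x, U * siteSpin n x 2 * Uᴴ = siteSpin n x 2) := by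
  obtain ⟨D, hD, hD', hDx, hDy, hDz⟩ := exists_unitary_conj_spinX_eq_neg_spinY n
  set U : Op (TorusSite d L) (n + 1) := productOp (fun _ : TorusSite d L => D) with hU
  have hu : ∀ z : TorusSite d L, (fun _ : TorusSite d L => D) z * ((fun _ : TorusSite d L => D) z)ᴴ = 1 :=
    fun _ => hD
  have hu' : ∀ z : TorusSite d L, ((fun _ : TorusSite d L => D) z)ᴴ * (fun _ : TorusSite d L => D) z = 1 :=
    fun _ => hD'
  have h0 : ∀ x : TorusSite d L, U * siteSpin n x 0 * Uᴴ = -siteSpin n x 1 := fun x => by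
    rw [hU, productOp_conj_siteSpin hu, spinVec_zero, hDx, onSite_neg']
    rfl
  have h1 : ∀ x : TorusSite d L, U * siteSpin n x 1 * Uᴴ = siteSpin n x 0 := fun x => by
    rw [hU, productOp_conj_siteSpin hu, spinVec_one, hDy]
    rfl
  have h2 : ∀ x : TorusSite d L, U * siteSpin n x 2 * Uᴴ = siteSpin n x 2 := fun x => by
    rw [hU, productOp_conj_siteSpin hu, spinVec_two, hDz]
    rfl
  have hb0 : ∀ x y : TorusSite d L, U * spinBond n 0 x y * Uᴴ = spinBond n 1 x y := fun x y => by
    rw [hU, productOp_conj_spinBond hu hu', spinVec_zero, hDx, onSite_neg', onSite_neg', neg_mul_neg,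
      neg_mul_neg, spinBond]
    rfl
  have hb1 : ∀ x y : TorusSite d L, U * spinBond n 1 x y * Uᴴ = spinBond n 0 x y := fun x y => by
    rw [hU, productOp_conj_spinBond hu hu', spinVec_one, hDy, spinBond]
    rfl
  have hb2 : ∀ x y : TorusSite d L, U * spinBond n 2 x y * Uᴴ = spinBond n 2 x y := fun x y => by
    rw [hU, productOp_conj_spinBond hu hu', spinVec_two, hDz, spinBond]
    rfl
  refine ⟨U, productOp_mul_conjTranspose hu, productOp_conjTranspose_mul hu', ?_, h0, h1, h2⟩
  rw [xyzBondHamiltonian₃, xyzBondHamiltonian₃, mul_neg, neg_mul, mul_sum, sum_mul]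
  congr 1
  refine sum_congr rfl fun e _ => ?_
  induction e using Sym2.ind with
  | h x y =>
    rw [Sym2.lift_mk, Sym2.lift_mk]
    show U * xyzBond₃ n a b c x y * Uᴴ = xyzBond₃ n b a c x y
    rw [xyzBond₃, xyzBond₃, mul_add, mul_add, add_mul, add_mul,
      mul_smul_comm, mul_smul_comm, mul_smul_comm, smul_mul_assoc, smul_mul_assoc, smul_mul_assoc,
      hb0, hb1, hb2]
    abel

/-- **The correlations in the swapped frame**: with `ω_J` the tracial ground state of `H₃(J)`,
`ω_{(a,b,c)}(Sˣ_xSˣ_y) = ω_{(b,a,c)}(Sʸ_xSʸ_y)`, `ω_{(a,b,c)}(Sʸ_xSʸ_y) = ω_{(b,a,c)}(Sˣ_xSˣ_y)`,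
`ω_{(a,b,c)}(Sᶻ_xSᶻ_y) = ω_{(b,a,c)}(Sᶻ_xSᶻ_y)`. [cite: BjornbergUeltschi2022, Proposition 2.4] -/
theorem xyz₃_groundStateFunctional_swap (a b c : ℝ) (x y : TorusSite d L) :
    (xyzBondHamiltonian₃ (d := d) L n a b c).groundStateFunctional (siteSpin n x 0 * siteSpin n y 0) =
      (xyzBondHamiltonian₃ (d := d) L n b a c).groundStateFunctional (siteSpin n x 1 * siteSpin n y 1) ∧
    (xyzBondHamiltonian₃ (d := d) L n a b c).groundStateFunctional (siteSpin n x 1 * siteSpin n y 1) =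
      (xyzBondHamiltonian₃ (d := d) L n b a c).groundStateFunctional (siteSpin n x 0 * siteSpin n y 0) ∧
    (xyzBondHamiltonian₃ (d := d) L n a b c).groundStateFunctional (siteSpin n x 2 * siteSpin n y 2) =
      (xyzBondHamiltonian₃ (d := d) L n b a c).groundStateFunctional (siteSpin n x 2 * siteSpin n y 2) := by
  obtain ⟨U, hU, hU', hH, h0, h1, h2⟩ := exists_swap_xyzBondHamiltonian₃ (d := d) L n a b c
  have key : ∀ O : Op (TorusSite d L) (n + 1),
      (xyzBondHamiltonian₃ (d := d) L n a b c).groundStateFunctional O =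
        (xyzBondHamiltonian₃ (d := d) L n b a c).groundStateFunctional (U * O * Uᴴ) := by
    intro O
    rw [← hH, Matrix.groundStateFunctional_unitary_conj hU hU']
  have hmul : ∀ A B : Op (TorusSite d L) (n + 1), U * (A * B) * Uᴴ = (U * A * Uᴴ) * (U * B * Uᴴ) := by
    intro A B
    simp only [mul_assoc]
    rw [← mul_assoc Uᴴ U, hU', one_mul]
  refine ⟨?_, ?_, ?_⟩
  · rw [key, hmul, h0, h0, neg_mul_neg]
  · rw [key, hmul, h1, h1]
  · rw [key, hmul, h2, h2]

end Three

/-! ### (PF) The correlation inequalities in the rotated frame `H' = H(1, J₂, J₁)` -/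

section PF

variable (L : ℕ) [NeZero L] (n : ℕ) (J₁ J₂ : ℝ)

/-- **B–U Lemma A.1 in the rotated frame, pointwise**: for `|J₂| ≤ J₁` and `x ≠ y`,
`|G¹(x,y)| ≤ G²(x,y)` for the ground-state correlations of `H' = H(1, J₂, J₁)` (B–U:
`|⟨S⁽²⁾_xS⁽²⁾_y⟩| ≤ ⟨S⁽¹⁾_xS⁽¹⁾_y⟩`; their axes `2, 1` are the components `1, 2` here). Via
`ω_{H(1,J₂,J₁)} = ω_{H₃(1,J₂,J₁)}`, the cyclic frame (`H₃(1,J₂,J₁) ↦ H₃(J₂,J₁,1)`), the swap frame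
(`↦ H₃(J₁,J₂,1)`) and Lemma A.1 for `H₃(J₁,J₂,1)`. [cite: BjornbergUeltschi2022, Lemma A.1] -/
theorem xyz_abs_groundCorr_one_le_two (hJ : -J₂ ≤ J₁) (hJ' : J₂ ≤ J₁) {x y : TorusSite d L}
    (hxy : x ≠ y) :
    |xyzGroundCorr 1 L n J₁ J₂ x y| ≤ xyzGroundCorr 2 L n J₁ J₂ x y := by
  rw [xyzGroundCorr_of_neZero, xyzGroundCorr_of_neZero, groundStateFunctional_anisotropicTorus_three]
  obtain ⟨-, ha1, ha2⟩ := xyz₃_groundStateFunctional_frame (d := d) L n 1 J₂ J₁ x y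
  obtain ⟨hb0, hb1, -⟩ := xyz₃_groundStateFunctional_swap (d := d) L n J₂ J₁ 1 x y
  rw [ha1, ha2, hb0, hb1]
  exact xyz₃_abs_groundCorr_one_le_zero L n J₁ J₂ 1 hJ hJ' hxy

/-- **(PF₁) averaged**: `|c¹| ≤ c²` on tori of side `L ≥ 2` for `|J₂| ≤ J₁` (`x ≠ x + eᵢ`).
[cite: BjornbergUeltschi2022, Lemma A.1] -/
theorem xyz_abs_bondCorr_one_le_two (hL : 2 ≤ L) (hJ : -J₂ ≤ J₁) (hJ' : J₂ ≤ J₁) :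
    |xyzBondCorr (d := d) 1 L n J₁ J₂| ≤ xyzBondCorr (d := d) 2 L n J₁ J₂ := by
  have hne : ∀ (x : TorusSite d L) (i : Fin d), x ≠ x + Pi.single i 1 := fun x i h =>
    single_ne_zero_of_two_le L hL i (by simpa using h.symm)
  have hden : 0 ≤ (d : ℝ) * (L : ℝ) ^ d := by positivity
  rw [xyzBondCorr_of_neZero, xyzBondCorr_of_neZero, abs_div, abs_of_nonneg hden]
  refine div_le_div_of_nonneg_right ?_ hden
  refine (abs_sum_le_sum_abs _ _).trans (sum_le_sum fun x _ => ?_)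
  refine (abs_sum_le_sum_abs _ _).trans (sum_le_sum fun i _ => ?_)
  exact xyz_abs_groundCorr_one_le_two L n J₁ J₂ hJ hJ' (hne x i)

/-- **(PF₂)** `c² ≤ c⁰` on even tori of side `2k ≥ 4` for `J₁ ≤ 1` (B–U: `⟨S⁽¹⁾S⁽¹⁾⟩ ≤ ⟨S⁽³⁾S⁽³⁾⟩`):
the orbit inequality (O)(iv) `(1 - J₁)(c⁰ - c²) ≥ 0` for `J₁ < 1`, and the symmetry `c⁰ = c²` at
`J₁ = 1`. [cite: BjornbergUeltschi2022, eq. (4.42) and Prop. 2.4] -/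
theorem xyz_bondCorr_two_le_zero (hd : 0 < d) (k : ℕ) (hk : 2 ≤ k) (hJ₁' : J₁ ≤ 1) :
    haveI : NeZero (2 * k) := ⟨by omega⟩
    xyzBondCorr (d := d) 2 (2 * k) n J₁ J₂ ≤ xyzBondCorr (d := d) 0 (2 * k) n J₁ J₂ := by
  haveI : NeZero (2 * k) := ⟨by omega⟩
  obtain ⟨-, -, -, h4⟩ := xyz_orbit_inequalities n J₁ J₂ hd k hk
  rcases hJ₁'.lt_or_eq with hlt | heq
  · nlinarith
  · subst heq
    exact le_of_eq (xyzBondCorr_zero_eq_two_of_J₁_eq_one (2 * k) n J₂ (d := d)).symm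

end PF

/-! ### The general assembly: B–U (4.39)–(4.42) in finite volume, and long-range order -/

section Assembly

variable (n : ℕ) (J₁ J₂ : ℝ)

/-- The sum rule with the zero momentum split off: `c⁰ |Λ| = ĝ₀ + Σ_{q ≠ 0} ĝ_q (d⁻¹ Σᵢ cos qᵢ)`.
[cite: BjornbergUeltschi2022, eq. (4.38)] -/
theorem xyz_sumRule_split (hd : 1 ≤ d) (L : ℕ) [NeZero L] :
    xyzBondCorr (d := d) 0 L n J₁ J₂ * (L : ℝ) ^ d =
      xyzStructureFactor L n J₁ J₂ (0 : TorusSite d L) +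
        ∑ q ∈ (univ : Finset (TorusSite d L)).erase 0,
          xyzStructureFactor L n J₁ J₂ q * (torusCosSum L q / d) := by
  have hd0 : (d : ℝ) ≠ 0 := by exact_mod_cast (show d ≠ 0 by omega)
  have hL : (L : ℝ) ^ d ≠ 0 := by
    have : (L : ℝ) ≠ 0 := by exact_mod_cast NeZero.ne L
    positivity
  rw [← xyz_structureFactor_sumRule hd L n J₁ J₂, div_mul_cancel₀ _ hL,
    ← add_sum_erase _ _ (mem_univ (0 : TorusSite d L)), torusCosSum_zero, div_self hd0, mul_one]

/-- **B–U (4.39)–(4.40) in finite volume.** On the even torus of side `L = 2k ≥ 4`, `d ≥ 1`: if the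
`T = 0` infrared bound holds at every `q ≠ 0` in the form `0 ≤ ĝ_q`, `ĝ_q² E_q ≤ ¼ Σᵢ (a - b cos qᵢ)`
with `|b| ≤ a`, then `c⁰ ≤ |Λ|⁻¹ ĝ₀ + ½ √a · R_L(d)` with the punctured Riemann sum
`R_L(d) = klsRiemannSum d L` of the KLS integrand (B–U's `Ĩ⁽ᵈ⁾_ℓ(r) ≤ Ĩ⁽ᵈ⁾_ℓ`, (4.41), here
termwise: only momenta with `Σᵢ cos qᵢ > 0` contribute and there `da - bC ≤ a(d + C)`,
`kls_pointwise`). [cite: BjornbergUeltschi2022, eqs. (4.38)–(4.41)] -/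
theorem xyz_ineq (hd : 1 ≤ d) {k : ℕ} (hk : 2 ≤ k) {a b : ℝ} (hab : |b| ≤ a)
    (hA : ∀ q : TorusSite d (2 * k), q ≠ 0 →
      0 ≤ xyzStructureFactor (2 * k) n J₁ J₂ q ∧
        xyzStructureFactor (2 * k) n J₁ J₂ q ^ 2 * dispersion (latticeMomentum (2 * k) q) ≤
          (1 / 4 : ℝ) * ∑ i, (a - b * Real.cos (latticeMomentum (2 * k) q i))) :
    haveI : NeZero (2 * k) := ⟨by omega⟩
    xyzBondCorr (d := d) 0 (2 * k) n J₁ J₂ ≤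
      xyzStructureFactor (2 * k) n J₁ J₂ (0 : TorusSite d (2 * k)) / ((2 * k : ℕ) : ℝ) ^ d +
        1 / 2 * Real.sqrt a * klsRiemannSum d (2 * k) := by
  haveI : NeZero (2 * k) := ⟨by omega⟩
  have hd0 : (0 : ℝ) < d := by exact_mod_cast (show 0 < d by omega)
  have hL : (0 : ℝ) < ((2 * k : ℕ) : ℝ) ^ d := by positivity
  have hsum : ∑ q ∈ (univ : Finset (TorusSite d (2 * k))).erase 0,
      xyzStructureFactor (2 * k) n J₁ J₂ q * (torusCosSum (2 * k) q / d) ≤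
      1 / 2 * Real.sqrt a * ∑ q ∈ (univ : Finset (TorusSite d (2 * k))).erase 0,
        klsIntegrand d (latticeMomentum (2 * k) q) := by
    rw [mul_sum]
    refine sum_le_sum fun q hq => ?_
    have hq0 : q ≠ 0 := (mem_erase.1 hq).1
    obtain ⟨hg, hAq⟩ := hA q hq0
    rw [sum_const_sub_mul_cos_latticeMomentum] at hAq
    rw [klsIntegrand_latticeMomentum]
    exact kls_pointwise hg (dispersion_latticeMomentum_pos hq0) hd0 hAq hab
  have hC := xyz_sumRule_split n J₁ J₂ hd (2 * k)
  rw [klsRiemannSum_of_neZero, ← mul_div_assoc, ← add_div, le_div_iff₀ hL, hC]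
  linarith

/-- `|β'| ≤ α'` for `α' = J₂c¹ + J₁c²`, `β' = J₁c¹ + J₂c²`: `J₂ ≤ 0`, `-J₂ ≤ J₁` and `|c¹| ≤ c²`
give `α' ∓ β' = (J₁ ∓ J₂)(c² ∓ c¹) ≥ 0` (B–U after (4.34): "it follows … that `r ∈ [-1, 1]`").
[cite: BjornbergUeltschi2022, after eq. (4.34)] -/
theorem xyz_abs_b_le_a {J₁ J₂ c₁ c₂ : ℝ} (hJ₂ : J₂ ≤ 0) (hJ₁₂ : -J₂ ≤ J₁) (hc : |c₁| ≤ c₂) :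
    |J₁ * c₁ + J₂ * c₂| ≤ J₂ * c₁ + J₁ * c₂ := by
  have hc₁ := abs_le.1 hc
  rw [abs_le]
  constructor
  · nlinarith [mul_nonneg (show 0 ≤ J₁ + J₂ by linarith) (show 0 ≤ c₂ + c₁ by linarith)]
  · nlinarith [mul_nonneg (show 0 ≤ J₁ - J₂ by linarith) (show 0 ≤ c₂ - c₁ by linarith)]

/-- **The order parameter is bounded below** (B–U's "at least one of the lower bounds is positive",
made quantitative in finite volume). On the even torus of side `2k ≥ 4`, `d ≥ 1`, with `J₁ ≤ 1`,
`0 ≤ -J₂ ≤ J₁`: the infrared bound (A) at this side, `|c¹| ≤ c² ≤ c⁰` and `R_L(d) ≤ ρ ≤ n/√6`,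
`0 ≤ ρ`, give `|Λ|⁻¹ ĝ₀ ≥ ½ t⋆ (t⋆ - ρ)`, `t⋆ = n/√6`: indeed `c⁰ ≤ |Λ|⁻¹ĝ₀ + ½√α' ρ`
(`xyz_ineq`), `c⁰ ≥ S² - α'` ((V)) and `c⁰ ≥ α'/2` (`α' ≤ (J₁ - J₂)c² ≤ 2c² ≤ 2c⁰`, B–U (4.42)),
and `max(S² - t², t²/2) - ½tρ ≥ ½t⋆(t⋆ - ρ)` for `t ≥ 0` (`S² = 3t⋆²/2`).
[cite: BjornbergUeltschi2022, Theorem 3.2 and (3.9)] -/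
theorem xyz_orderParameter_lower (hd : 1 ≤ d) {k : ℕ} (hk : 2 ≤ k)
    (hJ₁' : J₁ ≤ 1) (hJ₂ : 0 ≤ -J₂) (hJ₂' : -J₂ ≤ J₁)
    (hA : haveI : NeZero (2 * k) := ⟨by omega⟩
      ∀ q : TorusSite d (2 * k), q ≠ 0 →
      0 ≤ xyzStructureFactor (2 * k) n J₁ J₂ q ∧
        xyzStructureFactor (2 * k) n J₁ J₂ q ^ 2 * dispersion (latticeMomentum (2 * k) q) ≤
          (1 / 4 : ℝ) * ∑ i, ((J₂ * xyzBondCorr (d := d) 1 (2 * k) n J₁ J₂ +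
              J₁ * xyzBondCorr (d := d) 2 (2 * k) n J₁ J₂) -
            (J₁ * xyzBondCorr (d := d) 1 (2 * k) n J₁ J₂ + J₂ * xyzBondCorr (d := d) 2 (2 * k) n J₁ J₂) *
              Real.cos (latticeMomentum (2 * k) q i)))
    (hPF₁ : haveI : NeZero (2 * k) := ⟨by omega⟩
      |xyzBondCorr (d := d) 1 (2 * k) n J₁ J₂| ≤ xyzBondCorr (d := d) 2 (2 * k) n J₁ J₂)
    (hPF₂ : haveI : NeZero (2 * k) := ⟨by omega⟩
      xyzBondCorr (d := d) 2 (2 * k) n J₁ J₂ ≤ xyzBondCorr (d := d) 0 (2 * k) n J₁ J₂)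
    {ρ : ℝ} (hρ0 : 0 ≤ ρ) (hρt : ρ ≤ n / Real.sqrt 6)
    (hR : haveI : NeZero (2 * k) := ⟨by omega⟩; klsRiemannSum d (2 * k) ≤ ρ) :
    haveI : NeZero (2 * k) := ⟨by omega⟩
    1 / 2 * (n / Real.sqrt 6) * (n / Real.sqrt 6 - ρ) ≤
      xyzStructureFactor (2 * k) n J₁ J₂ (0 : TorusSite d (2 * k)) / ((2 * k : ℕ) : ℝ) ^ d := by
  haveI : NeZero (2 * k) := ⟨by omega⟩
  have hd0 : 0 < d := by omega
  set c₀ := xyzBondCorr (d := d) 0 (2 * k) n J₁ J₂ with hc₀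
  set c₁ := xyzBondCorr (d := d) 1 (2 * k) n J₁ J₂ with hc₁
  set c₂ := xyzBondCorr (d := d) 2 (2 * k) n J₁ J₂ with hc₂
  set m := xyzStructureFactor (2 * k) n J₁ J₂ (0 : TorusSite d (2 * k)) / ((2 * k : ℕ) : ℝ) ^ d
    with hm
  set tstar : ℝ := n / Real.sqrt 6 with htstar
  have hab : |J₁ * c₁ + J₂ * c₂| ≤ J₂ * c₁ + J₁ * c₂ := xyz_abs_b_le_a (by linarith) hJ₂' hPF₁
  set a := J₂ * c₁ + J₁ * c₂ with ha
  have ha0 : 0 ≤ a := (abs_nonneg _).trans hab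
  -- (4.39)–(4.40): `c₀ ≤ m + ½ √a R ≤ m + ½ √a ρ`
  have hineq := xyz_ineq n J₁ J₂ hd hk hab hA
  have hR0 : 0 ≤ klsRiemannSum d (2 * k) := klsRiemannSum_nonneg _ _
  set t := Real.sqrt a with ht
  have ht0 : 0 ≤ t := Real.sqrt_nonneg a
  have hta : t ^ 2 = a := Real.sq_sqrt ha0
  have h1 : c₀ ≤ m + 1 / 2 * t * ρ := by
    have : 1 / 2 * t * klsRiemannSum d (2 * k) ≤ 1 / 2 * t * ρ := by nlinarith
    linarith
  -- (V): `S² ≤ c₀ + a`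
  have hV := xyz_polarised_bound (2 * k) n J₁ J₂ (by omega) hd0
  rw [← hc₀, ← hc₁, ← hc₂] at hV
  have hV' : ((n : ℝ) / 2) ^ 2 ≤ a + c₀ := by rw [ha]; linarith
  -- (4.42): `a ≤ 2 c₀`
  have hc₁' := abs_le.1 hPF₁
  have hc₂0 : 0 ≤ c₂ := (abs_nonneg c₁).trans hPF₁
  have h2 : a ≤ 2 * c₀ := by
    have hs : 0 ≤ c₂ + c₁ := by linarith [hc₁'.1]
    have hJs : J₂ * (c₂ + c₁) ≤ 0 := mul_nonpos_of_nonpos_of_nonneg (by linarith) hs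
    have h3 : a ≤ (J₁ - J₂) * c₂ := by rw [ha]; nlinarith
    have h4 : (J₁ - J₂) * c₂ ≤ 2 * c₂ := mul_le_mul_of_nonneg_right (by linarith) hc₂0
    linarith
  -- the constants: `S² = 3 t⋆² / 2`
  have h6 : (0 : ℝ) < Real.sqrt 6 := Real.sqrt_pos.2 (by norm_num)
  have htstar2 : tstar ^ 2 = (n : ℝ) ^ 2 / 6 := by
    rw [htstar, div_pow, Real.sq_sqrt (by norm_num : (0 : ℝ) ≤ 6)]
  have hS : ((n : ℝ) / 2) ^ 2 = 3 * tstar ^ 2 / 2 := by rw [htstar2]; ring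
  have htstar0 : 0 ≤ tstar := by positivity
  -- case analysis on `t` versus `t⋆`
  rcases le_or_gt tstar t with hle | hlt
  · -- `t ≥ t⋆`: `m ≥ t²/2 - ½tρ = ½t(t - ρ) ≥ ½t⋆(t⋆ - ρ)` as `(t - t⋆)(t + t⋆ - ρ) ≥ 0`
    have hm1 : 1 / 2 * t * (t - ρ) ≤ m := by nlinarith
    nlinarith [mul_nonneg (sub_nonneg.2 hle) (show 0 ≤ t + tstar - ρ by linarith)]
  · -- `t < t⋆`: `m ≥ S² - t² - ½tρ ≥ S² - t⋆² - ½t⋆ρ = ½t⋆(t⋆ - ρ)` (decreasing in `t`)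
    have hm2 : ((n : ℝ) / 2) ^ 2 - t ^ 2 - 1 / 2 * t * ρ ≤ m := by nlinarith
    nlinarith [mul_nonneg (sub_nonneg.2 hlt.le) (show 0 ≤ t + tstar + ρ / 2 by linarith)]

/-- **Long-range order from (A), (PF) and an eventual bound on the Riemann sums** (the ground-state
consequence of B–U Theorem 3.2, second bound, in the tree's finite-volume form). For `d ≥ 2`, spin
`S = n/2 ≥ ½`, `J₁ ≤ 1`, `0 ≤ -J₂ ≤ J₁`: if on every even torus of side `2k ≥ 4` the `T = 0`
infrared bound (A) and the correlation inequalities `|c¹| ≤ c² ≤ c⁰` hold, and `R_L(d) ≤ ρ < n/√6`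
for all large `L`, then the ground states of B–U's Hamiltonian have long-range order in the third
component along even tori. [cite: BjornbergUeltschi2022, Theorem 3.2 and pp. 10–11] -/
theorem xyz_lro_of_infraredBound (hd : 2 ≤ d) {n : ℕ} (hn : 1 ≤ n) {J₁ J₂ : ℝ}
    (hJ₁' : J₁ ≤ 1) (hJ₂ : 0 ≤ -J₂) (hJ₂' : -J₂ ≤ J₁)
    (hA : ∀ k : ℕ, (hk : 2 ≤ k) → haveI : NeZero (2 * k) := ⟨by omega⟩
      ∀ q : TorusSite d (2 * k), q ≠ 0 →
      0 ≤ xyzStructureFactor (2 * k) n J₁ J₂ q ∧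
        xyzStructureFactor (2 * k) n J₁ J₂ q ^ 2 * dispersion (latticeMomentum (2 * k) q) ≤
          (1 / 4 : ℝ) * ∑ i, ((J₂ * xyzBondCorr (d := d) 1 (2 * k) n J₁ J₂ +
              J₁ * xyzBondCorr (d := d) 2 (2 * k) n J₁ J₂) -
            (J₁ * xyzBondCorr (d := d) 1 (2 * k) n J₁ J₂ + J₂ * xyzBondCorr (d := d) 2 (2 * k) n J₁ J₂) *
              Real.cos (latticeMomentum (2 * k) q i)))
    (hPF : ∀ k : ℕ, (hk : 2 ≤ k) → haveI : NeZero (2 * k) := ⟨by omega⟩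
      |xyzBondCorr (d := d) 1 (2 * k) n J₁ J₂| ≤ xyzBondCorr (d := d) 2 (2 * k) n J₁ J₂ ∧
        xyzBondCorr (d := d) 2 (2 * k) n J₁ J₂ ≤ xyzBondCorr (d := d) 0 (2 * k) n J₁ J₂)
    (hρ : ∃ ρ : ℝ, ρ < n / Real.sqrt 6 ∧ ∀ᶠ L : ℕ in atTop, klsRiemannSum d L ≤ ρ) :
    HasEvenTorusLRO (fun L x y => groundStateAxisCorrTorus (d := d) L n J₁ J₂ 1 x y) := by
  rw [hasEvenTorusLRO_iff]
  obtain ⟨ρ, hρlt, hρev⟩ := hρ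
  have hd1 : 1 ≤ d := by omega
  set tstar : ℝ := n / Real.sqrt 6 with htstar
  have h6 : (0 : ℝ) < Real.sqrt 6 := Real.sqrt_pos.2 (by norm_num)
  have hn1 : (1 : ℝ) ≤ n := by exact_mod_cast hn
  have htpos : 0 < tstar := by positivity
  -- `ρ₊ = max ρ 0 < t⋆`
  set ρ' : ℝ := max ρ 0 with hρ'_def
  have hρ'0 : 0 ≤ ρ' := le_max_right _ _
  have hρ'lt : ρ' < tstar := max_lt hρlt htpos
  set c : ℝ := 1 / 2 * tstar * (tstar - ρ') with hc_def
  have hc : 0 < c := by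
    have : 0 < tstar - ρ' := by linarith
    positivity
  -- eventually `R_{2k} ≤ ρ'`
  have h2k : Tendsto (fun k : ℕ => 2 * k) atTop atTop :=
    tendsto_atTop_atTop.2 fun b => ⟨b, fun k hk => by omega⟩
  have hRk : ∀ᶠ k : ℕ in atTop, klsRiemannSum d (2 * k) ≤ ρ' :=
    (h2k.eventually hρev).mono fun k hk => hk.trans (le_max_left _ _)
  -- eventually the LRO sequence is `≥ c`
  have hev : ∀ᶠ k : ℕ in atTop, c ≤
      (∑ x ∈ halfOpenBox d (2 * k), ∑ y ∈ halfOpenBox d (2 * k),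
          torusPullback (fun L x y => groundStateAxisCorrTorus (d := d) L n J₁ J₂ 1 x y) (2 * k) x y) /
        ((halfOpenBox d (2 * k)).card : ℝ) ^ 2 := by
    filter_upwards [hRk, eventually_ge_atTop 2] with k hk hk2
    rw [xyz_lroSeq_eq n k (by omega) J₁ J₂, hc_def]
    obtain ⟨hPF₁, hPF₂⟩ := hPF k hk2
    exact xyz_orderParameter_lower n J₁ J₂ hd1 hk2 hJ₁' hJ₂ hJ₂' (hA k hk2) hPF₁ hPF₂ hρ'0 hρ'lt.le hk
  exact hc.trans_le
    (le_liminf_of_le (isCoboundedUnder_ge_of_le atTop fun k => xyz_lroSeq_le n k J₁ J₂) hev)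

/-! ### The numerical input, from the tree -/

/-- **The Riemann sums are eventually below the threshold `n/√6`** for every `(d, n)` with
`d ≥ 2`, `n ≥ 1`, `(d, n) ≠ (2, 1)`: for `n ≥ 2`, `R_L(d) ≤ 0.69 < 1/√2 < 2/√6`
(`klsRiemannSum_eventually_le`); for `n = 1`, `d ≥ 3`, `lim_L R_L(d) = I(d) ≤ I(3) = lim R_L(3) ≤ 2/5`
(`klsRiemannSum_tendsto_holds`, `klsIntegral_antitone`, `klsRiemannSum_three_eventually_le`) and
`2/5 < 1/√6`. (B–U, Table 1: `Ĩ⁽²⁾ = 0.6468`, `Ĩ⁽³⁾ = 0.3499`, `Ĩ⁽⁴⁾ = 0.2540`.)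
[cite: BjornbergUeltschi2022, Table 1 and (3.9)] -/
theorem xyz_riemannSum_eventually_lt (hR3 : ∃ ρ : ℝ, ρ < 1 / Real.sqrt 6 ∧
      ∀ᶠ L : ℕ in atTop, klsRiemannSum 3 L ≤ ρ)
    {d n : ℕ} (hd : 2 ≤ d) (hn : 1 ≤ n) (hdn : ¬ (d = 2 ∧ n = 1)) :
    ∃ ρ : ℝ, ρ < n / Real.sqrt 6 ∧ ∀ᶠ L : ℕ in atTop, klsRiemannSum d L ≤ ρ := by
  have h6 : (0 : ℝ) < Real.sqrt 6 := Real.sqrt_pos.2 (by norm_num)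
  rcases Nat.lt_or_ge n 2 with hn1 | hn2
  · obtain rfl : n = 1 := by omega
    have hd3 : 3 ≤ d := by omega
    obtain ⟨ρ, hρ, hev⟩ := hR3
    -- `I(3) ≤ ρ`
    have hI3 : klsIntegral 3 ≤ ρ :=
      le_of_tendsto (klsRiemannSum_tendsto_holds 3 (by norm_num)) hev
    -- `I(d) ≤ I(3) ≤ ρ < 1/√6`
    have hId : klsIntegral d ≤ ρ := (klsIntegral_antitone (by norm_num) hd3).trans hI3
    refine ⟨(ρ + 1 / Real.sqrt 6) / 2, ?_, ?_⟩
    · push_cast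
      linarith
    · have hlt : ∀ᶠ L : ℕ in atTop, klsRiemannSum d L < (ρ + 1 / Real.sqrt 6) / 2 :=
        (klsRiemannSum_tendsto_holds d hd).eventually_lt_const (by linarith)
      exact hlt.mono fun L hL => hL.le
  · obtain ⟨ρ, hρ, hev⟩ := klsRiemannSum_eventually_le d hd
    refine ⟨ρ, ?_, hev⟩
    have hn2' : (2 : ℝ) ≤ n := by exact_mod_cast hn2
    have h2 : 2 / Real.sqrt 6 ≤ n / Real.sqrt 6 := div_le_div_of_nonneg_right hn2' h6.le
    linarith [sqrt_two_div_two_lt_two_div_sqrt_six]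

end Assembly

/-- **Björnberg–Ueltschi 2022, ground-state long-range order — discharge of the named fact
`bjornbergUeltschi2022_ground_lro`.** For every `d ≥ 2`, spin `S = n/2 ≥ ½` with `(d, S) ≠ (2, ½)`,
and couplings `0 < J₁ ≤ 1`, `0 ≤ -J₂ ≤ J₁` (third coupling `1`), the ground states of B–U's
nearest-neighbour Hamiltonian on the even tori `(ℤ/2kℤ)^d` have long-range order of the third spin
component: `liminf_k (2k)^{-2d} Σ_{x,y} ⟨S³_xS³_y⟩_GS > 0`. Inputs: ground-state Gaussian domination
by reflection positivity (`buSpinHalf_gaussianDomination`, `XYZGroundStateOrderGD.lean`) ⇒ the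
`T = 0` infrared bound (`xyz_infraredBound_of_groundEnergy_le`); B–U Lemma A.1 in the ground state
(`xyz_abs_bondCorr_one_le_two`) and the orbit inequality (`xyz_bondCorr_two_le_zero`); the sum rule
and the polarised-state bound (`XYZGroundStateOrderProofs.lean`); and the certified Riemann sums of
the tree (`klsRiemannSum_three_eventually_le`, `klsRiemannSum_eventually_le`, `klsIntegral_antitone`,
`klsRiemannSum_tendsto_holds`) in place of the numerical Table 1.
[cite: BjornbergUeltschi2022, Theorem 3.2, (3.9), Table 1, pp. 10–11] -/
theorem bjornbergUeltschi2022_ground_lro_holds : bjornbergUeltschi2022_ground_lro := by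
  intro d n hd hn hdn J₁ J₂ hJ₁ hJ₁' hJ₂ hJ₂'
  refine xyz_lro_of_infraredBound hd hn hJ₁' hJ₂ hJ₂' (fun k hk q hq => ?_) (fun k hk => ?_)
    (xyz_riemannSum_eventually_lt klsRiemannSum_three_eventually_le hd hn hdn)
  · haveI : NeZero (2 * k) := ⟨by omega⟩
    exact xyz_infraredBound_of_groundEnergy_le (2 * k) n J₁ J₂ (by omega) (by omega)
      (fun h => buSpinHalf_gaussianDomination (2 * k) n (even_two_mul k) (by omega) hJ₁.le
        (by linarith) h) q hq
  · haveI : NeZero (2 * k) := ⟨by omega⟩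
    exact ⟨xyz_abs_bondCorr_one_le_two (2 * k) n J₁ J₂ (by omega) hJ₂' (by linarith),
      xyz_bondCorr_two_le_zero n J₁ J₂ (by omega) k hk hJ₁'⟩

end Literature.MathematicalPhysics.QuantumLattice
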